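import Literature.IUT.HodgeTheaters.GlobalFrobenioidsCyclotomeIsoGenuineKummer
import HarnessLib

/-!
# [IUTchI] Example 5.1 (v), p. 128 l. 1–12 — the one-layer cyclotome display E51/L27 (`UniqueCyclotomeIso`) in
# HALF-GENUINE form: Frobenioid side + container GENUINE (the ∞κ Kummer container of the Ex. 5.1 (i) data over
# the canonical levels), étale side an INTERFACE under two laws (E) (T) — proofs only

S. Mochizuki, *Inter-universal Teichmüller theory I*, kurims manuscript (May 2020), §5 Example 5.1 (v), p. 127
l. 75 – p. 128 l. 12 ([IUTchI] Ex 5.1 (v) pp.127–128) [claim: Mochizuki2012, status: disputed]: "there exists a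
unique isomorphism of cyclotomes `μ^Θ_Ẑ(π₁(†𝒟^⊚)) ⥲ μ_Ẑ(†𝕄^⊛_∞κ)` such that the resulting isomorphism between
direct limits of cohomology modules induces an isomorphism `𝕄^⊛_∞κ(†𝒟^⊚) ⥲ †𝕄^⊛_∞κ`".  LANA §6.1 pp. 31–32
[LANA2026Report]: the Kummer container `lim_{→ H} H¹(H, Λ(A))` and its `Ẑ^×`-module structure.

Cell abc-iut; PROOF-ONLY corollary file (theorems only: no `def`, no `instance`, no `structure`, no new `Prop` fact)
of abc-iut-f-190's `GlobalFrobenioidsCyclotomeIsoGenuineKummer.lean` (p443183), sub-DAG row E51/L27, for the LAYER-5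
certificate (`Summit.ABC.IUTFork.Conditional.layer5_held_ex51v_*`).  That file proves the display for the SYMMETRIC
genuine datum — both cyclotomes `Λ(K_rat^×)`, both containers the genuine `lim_{→ H} H¹(H, Λ(K_rat^×))` over all open
normal subgroups `H` of `π₁^rat(†𝒟^⊛)`, both subsets the genuine Kummer classes `κ(𝕄^⊛_∞κ)`, induced map = container
twist by the cyclotomic character — from conjunct 1's field-level binders `hrootU hprim hdiv ord hordmul hpole hex`.
In print the ÉTALE-LIKE side (`μ^Θ_Ẑ(π₁(†𝒟^⊚))`, its container, `𝕄^⊛_∞κ(†𝒟^⊚)`, the induced maps) is the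
[AbsTopIII] Thm 1.9 reconstruction output — FACT-policy in this cell, an INTERFACE, not the Frobenioid side itself.
**This file: the certificate form.**  §1 `UniqueCyclotomeIso.of_symmetric_of_etale_laws` — pure algebra: if the
symmetric comparison at a container `H` with an `Aut(μ)`-action `act` by injective maps has NO non-trivial
automorphism of `μ` carrying `im` bijectively onto itself, then for ANY étale-like interface `(μ₁, H₁, im₁, induced)`
satisfying (E) «some `e₀ : μ₁ ⥲ μ` induces `im₁ ⥲ im`» and (T) «`induced (w ∘ e) = act w ∘ induced e`» the
display `∃! e, induced e : im₁ ⥲ im` holds (the unique `e` is `e₀`).  §2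
`NFBridgeRecon.uniqueCyclotomeIso_infκ_fieldLevel_of_etale_laws` — **E51/L27 HALF-GENUINE**: target side = f-190's
genuine datum (cyclotome `Λ(K_rat^×)`, genuine container over the canonical levels, `κ(𝕄^⊛_∞κ)`, container action
`H1ColimTwist`), étale side abstract DATA under the two laws (E) `hE` (the [AbsTopIII] Thm 1.9 (d) input) and (T) `hT`
(functoriality of the étale-side realisation under the `Ẑ^×`-twist, `Aut(Λ(K_rat^×)) = Ẑ^×` being abc-iut-w4-d056's
theorem `cyclotome.zhatTwist_bijective`), plus conjunct 1's field-level binders — NO (D)/two-zeroes/one-pole laws, NO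
`zμ`/`ordC` data.  §3 `NFBridgeRecon.etale_laws_infκ_fieldLevel_symmetric` — NON-VACUITY: (E) and (T) hold at the
symmetric datum (étale side := Frobenioid side), so the pair is jointly satisfiable whenever conjunct 1's binders are
(inhabited ≠ discharged).

HONEST FRAMING: a kernel theorem about OUR typed interface `NFBridgeRecon` at OUR genuine Kummer container; the
étale-like side is MODELLED as interface data (its production is [AbsTopIII] Thm 1.9 (d)(e), FACT-policy, never
asserted); the "respectively `∞κ×`" clause is not covered; no side is taken on [IUTchIII] Cor. 3.12; nothing of the
disputed series is asserted; typed ≠ proved; instantiated ≠ endorsed.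
-/

namespace Literature.IUT.HodgeTheaters

open ProfiniteGrp ProfiniteGrp.ProfiniteCompletion
open Literature.AnabelianGeometry.EtaleTheta Literature.AnabelianGeometry.EtaleTheta.ZHatLevel

universe u

/-! ## §1 Pure algebra: the half-genuine display from the symmetric one plus the étale laws (E) (T) -/

/-- **Half-genuine `UniqueCyclotomeIso` from the symmetric rigidity.**  Let `μ` be a cyclotome with an action
`act : Aut(μ) → (H → H)` on a container `H` by injective maps, and `im ⊆ H`; assume RIGIDITY of the symmetric datum:
the only `w ∈ Aut(μ)` with `act w : im ⥲ im` is `w = 1`.  Then for every étale-like interface — a cyclotome `μ₁`, a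
container `H₁`, a subset `im₁` and realisation maps `induced e : H₁ → H` (`e : μ₁ ⥲ μ`) — satisfying (E) some `e₀`
induces `im₁ ⥲ im` and (T) `induced (w ∘ e) = act w ∘ induced e`, there is EXACTLY ONE `e` inducing `im₁ ⥲ im`
(namely `e₀`: for another `e`, `w := e ∘ e₀⁻¹` carries `im` bijectively onto itself, so `w = 1`).
([IUTchI] Ex 5.1 (v) p.128) [claim: Mochizuki2012, status: disputed] -/
theorem UniqueCyclotomeIso.of_symmetric_of_etale_laws {μ₁ μ H₁ H : Type u} [CommGroup μ₁] [CommGroup μ]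
    (im₁ : Set H₁) (im : Set H) (induced : (μ₁ ≃* μ) → H₁ → H) (act : MulAut μ → H → H)
    (hrigid : ∀ w : MulAut μ, Set.BijOn (act w) im im → w = 1)
    (hinj : ∀ w : MulAut μ, Function.Injective (act w))
    (hE : ∃ e₀ : μ₁ ≃* μ, Set.BijOn (induced e₀) im₁ im)
    (hT : ∀ (e : μ₁ ≃* μ) (w : MulAut μ) (h : H₁), induced (e.trans w) h = act w (induced e h)) :
    UniqueCyclotomeIso
      { μ₁ := μ₁, μ₂ := μ, H₁ := H₁, H₂ := H, im₁ := im₁, im₂ := im, induced := induced } := by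
  obtain ⟨e₀, he₀⟩ := hE
  refine ⟨⟨e₀, he₀, fun e he => ?_⟩⟩
  change Set.BijOn (induced e) im₁ im at he
  -- `e = w ∘ e₀` for `w := e ∘ e₀⁻¹`
  have heq : e = e₀.trans (e₀.symm.trans e) := MulEquiv.ext fun x => by
    rw [MulEquiv.trans_apply, MulEquiv.trans_apply, MulEquiv.symm_apply_apply]
  -- `act w` carries `im` bijectively onto itself
  have hw : Set.BijOn (act (e₀.symm.trans e)) im im := by
    have hTw : ∀ h, induced e h = act (e₀.symm.trans e) (induced e₀ h) := fun h => by
      rw [← hT e₀ (e₀.symm.trans e) h, ← heq]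
    refine ⟨fun h hh => ?_, (hinj _).injOn, fun h hh => ?_⟩
    · obtain ⟨h₁, hh₁, rfl⟩ := he₀.surjOn hh
      rw [← hTw h₁]
      exact he.mapsTo hh₁
    · obtain ⟨h₁, hh₁, rfl⟩ := he.surjOn hh
      exact ⟨induced e₀ h₁, he₀.mapsTo hh₁, (hTw h₁).symm⟩
  rw [heq, hrigid _ hw]
  exact MulEquiv.ext fun x => rfl

namespace NFBridgeRecon

variable (N : NFBridgeRecon.{0})

/-! ## §2 E51/L27 half-genuine at the genuine ∞κ Kummer container over the canonical levels, field level -/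

open scoped Classical in
/-- **[IUTchI] Ex. 5.1 (v), E51/L27 — HALF-GENUINE, FIELD LEVEL.**  Frobenioid side GENUINE (abc-iut-f-190's datum,
p443183): target cyclotome `μ_Ẑ(†𝕄^⊛_∞κ) = Λ(K_rat^×)`, container the genuine `lim_{→ H} H¹(H, Λ(K_rat^×))` over ALL
open normal subgroups `H` of `π₁^rat(†𝒟^⊛)` (p.127), subset the genuine Kummer classes `κ(𝕄^⊛_∞κ)`, container
action `H1ColimTwist`; units action = Mathlib's `Units.mulDistribMulActionRight`, rootability from `hrootU`.
Étale-like side = interface DATA: cyclotome `μ^Θ_Ẑ(π₁(†𝒟^⊚)) =: μ₁`, container `H₁`, `𝕄^⊛_∞κ(†𝒟^⊚) =: im₁`, and the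
maps `induced e` "between direct limits of cohomology modules" ([AbsTopIII] Thm 1.9 (d), FACT-policy), under exactly
TWO laws: (E) `hE` — some isomorphism of cyclotomes induces `𝕄^⊛_∞κ(†𝒟^⊚) ⥲ †𝕄^⊛_∞κ` (the printed existence
claim = the Thm 1.9 (d) input) — and (T) `hT` — functoriality of the étale-side realisation under the `Ẑ^×`-twist of
the coefficients.  The remaining hypotheses are conjunct 1's field-level binders `hrootU hprim hdiv ord hordmul hpole
hex` (abc-iut-w4-d056 p436822), through f-190's symmetric rigidity `uniqueCyclotomeIso_infκ_fieldLevel`; law (T)'s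
torsor half is `Aut(Λ(K_rat^×)) = Ẑ^×` (`cyclotome.zhatTwist_bijective`).  Conclusion: EXACTLY ONE isomorphism of
cyclotomes induces `im₁ ⥲ κ(𝕄^⊛_∞κ)`.  NO (D)/two-zeroes/one-pole law binders, NO `zμ`/`twist`/`ordC` data.
([IUTchI] Ex 5.1 (v) p.128) [claim: Mochizuki2012, status: disputed] -/
theorem uniqueCyclotomeIso_infκ_fieldLevel_of_etale_laws
    (hrootU : ∀ {n : ℕ}, n ≠ 0 → Function.Surjective fun a : N.Kratˣ => a ^ n)
    (hprim : ∀ n : ℕ, 0 < n → ∃ ζ : N.Krat, IsPrimitiveRoot ζ n)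
    (hdiv : ∀ (H : OpenNormalSubgroup N.piRat) (a : N.Krat), a ≠ 0 → (∀ h : N.piRat, h ∈ H → h • a = a) →
      (∀ n : ℕ+, ∃ b : N.Krat, (∀ h : N.piRat, h ∈ H → h • b = b) ∧ b ^ (n : ℕ) = a) → a = 1)
    {X : Type*} (ord : X → N.Krat → ℤ)
    (hordmul : ∀ (x : X) (a b : N.Krat), a ≠ 0 → b ≠ 0 → (∀ g : N.piRat, g • a = a) → (∀ g : N.piRat, g • b = b) →
      ord x (a * b) = ord x a + ord x b)
    (hpole : ∀ f' ∈ N.Minfκ, (∀ g : N.piRat, g • f' = f') →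
      ∀ x₁ x₂ : X, x₁ ≠ x₂ → ¬ (ord x₁ f' < 0 ∧ ord x₂ f' < 0))
    (hex : ∃ f ∈ N.Minfκ, (∀ g : N.piRat, g • f = f) ∧
      ∃ x₁ x₂ : X, x₁ ≠ x₂ ∧ 0 < ord x₁ f ∧ 0 < ord x₂ f)
    -- DATA: the étale-like side ([AbsTopIII] Thm 1.9 outputs, an interface)
    (μ₁ : Type) [CommGroup μ₁] (H₁ : Type) (im₁ : Set H₁)
    (induced : (μ₁ ≃* cyclotome N.Kratˣ) → H₁ →
      letI : MulDistribMulAction N.piRat N.Kratˣ := Units.mulDistribMulActionRight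
      H1Colimit N.Kratˣ
        (fun i : (OpenNormalSubgroup N.piRat)ᵒᵈ => ((OrderDual.ofDual i : OpenNormalSubgroup N.piRat) : Subgroup N.piRat))
        N.openNormal_antitone)
    -- LAW (E): [AbsTopIII] Thm 1.9 (d) — some isomorphism of cyclotomes induces `𝕄^⊛_∞κ(†𝒟^⊚) ⥲ †𝕄^⊛_∞κ`
    (hE : ∃ e₀ : μ₁ ≃* cyclotome N.Kratˣ,
      letI : MulDistribMulAction N.piRat N.Kratˣ := Units.mulDistribMulActionRight
      letI : RootableBy N.Kratˣ ℕ := rootableByOfPowLeftSurj N.Kratˣ ℕ hrootU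
      haveI : Nonempty (OpenNormalSubgroup N.piRat)ᵒᵈ :=
        ⟨OrderDual.toDual { toOpenSubgroup := ⊤, isNormal' := Subgroup.normal_of_characteristic ⊤ }⟩
      Set.BijOn (induced e₀) im₁ (Set.range fun f : N.infκPair.carrier =>
        kummerMap N.openNormal_antitone (N.isExhausted_openNormal fun _ _ => rfl)
          (Units.mk0 (f : N.Krat) (N.coe_infκPair_ne_zero f))))
    -- LAW (T): functoriality of the étale-side realisation under the `Ẑ^×`-twist of the coefficients
    (hT : ∀ (e : μ₁ ≃* cyclotome N.Kratˣ) (u : MulAut (completion (GrpCat.of (Multiplicative ℤ)))) (h : H₁),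
      letI : MulDistribMulAction N.piRat N.Kratˣ := Units.mulDistribMulActionRight
      induced (e.trans (cyclotome.zhatTwist N.Kratˣ u)) h =
        H1ColimTwist
          (fun i : (OpenNormalSubgroup N.piRat)ᵒᵈ => ((OrderDual.ofDual i : OpenNormalSubgroup N.piRat) : Subgroup N.piRat))
          N.openNormal_antitone u (induced e h)) :
    letI : MulDistribMulAction N.piRat N.Kratˣ := Units.mulDistribMulActionRight
    letI : RootableBy N.Kratˣ ℕ := rootableByOfPowLeftSurj N.Kratˣ ℕ hrootU
    haveI : Nonempty (OpenNormalSubgroup N.piRat)ᵒᵈ :=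
      ⟨OrderDual.toDual { toOpenSubgroup := ⊤, isNormal' := Subgroup.normal_of_characteristic ⊤ }⟩
    UniqueCyclotomeIso
      { μ₁ := μ₁
        μ₂ := cyclotome N.Kratˣ
        H₁ := H₁
        H₂ := H1Colimit N.Kratˣ
          (fun i : (OpenNormalSubgroup N.piRat)ᵒᵈ => ((OrderDual.ofDual i : OpenNormalSubgroup N.piRat) : Subgroup N.piRat))
          N.openNormal_antitone
        im₁ := im₁
        im₂ := Set.range fun f : N.infκPair.carrier =>
          kummerMap N.openNormal_antitone (N.isExhausted_openNormal fun _ _ => rfl)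
            (Units.mk0 (f : N.Krat) (N.coe_infκPair_ne_zero f))
        induced := induced } := by
  letI : MulDistribMulAction N.piRat N.Kratˣ := Units.mulDistribMulActionRight
  letI : RootableBy N.Kratˣ ℕ := rootableByOfPowLeftSurj N.Kratˣ ℕ hrootU
  haveI : Nonempty (OpenNormalSubgroup N.piRat)ᵒᵈ :=
    ⟨OrderDual.toDual { toOpenSubgroup := ⊤, isNormal' := Subgroup.normal_of_characteristic ⊤ }⟩
  -- the symmetric rigidity (abc-iut-f-190): the unique automorphism of `Λ(K_rat^×)` preserving `κ(𝕄^⊛_∞κ)` is `1`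
  have hsym := (N.uniqueCyclotomeIso_infκ_fieldLevel hrootU hprim hdiv ord hordmul hpole hex).existsUnique
  -- the cyclotomic character `χ : Aut(Λ(K_rat^×)) ⥲ Ẑ^×`, inverse to `zhatTwist`
  set χ := (Equiv.ofBijective _ (cyclotome.zhatTwist_bijective (R := N.Krat) hprim)).symm with hχ
  have hχ_twist : ∀ w : MulAut (cyclotome N.Kratˣ), cyclotome.zhatTwist N.Kratˣ (χ w) = w :=
    fun w => Equiv.ofBijective_apply_symm_apply _ _ w
  have hχ_one : χ 1 = 1 := by
    rw [hχ, Equiv.symm_apply_eq]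
    exact (map_one (cyclotome.zhatTwist N.Kratˣ)).symm
  refine UniqueCyclotomeIso.of_symmetric_of_etale_laws im₁ _ induced
    (fun w z => H1ColimTwist _ N.openNormal_antitone (χ w) z) ?_ ?_ hE ?_
  · -- rigidity: `w` and `1` both satisfy the symmetric clause, so `w = 1`
    intro w hw
    have h1 : Set.BijOn (fun z => H1ColimTwist _ N.openNormal_antitone (χ 1) z)
        (Set.range fun f : N.infκPair.carrier =>
          kummerMap N.openNormal_antitone (N.isExhausted_openNormal fun _ _ => rfl)
            (Units.mk0 (f : N.Krat) (N.coe_infκPair_ne_zero f)))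
        (Set.range fun f : N.infκPair.carrier =>
          kummerMap N.openNormal_antitone (N.isExhausted_openNormal fun _ _ => rfl)
            (Units.mk0 (f : N.Krat) (N.coe_infκPair_ne_zero f))) :=
      (Set.bijOn_id _).congr fun z _ => by
        change z = H1ColimTwist _ N.openNormal_antitone (χ 1) z
        rw [hχ_one, H1ColimTwist_one_apply]
    exact hsym.unique hw h1
  · -- the twists are injective (the twist by `v⁻¹` inverts the twist by `v`)
    intro w z₁ z₂ hz
    have h := congrArg (H1ColimTwist _ N.openNormal_antitone (χ w)⁻¹) hz
    rwa [← H1ColimTwist_mul_apply, ← H1ColimTwist_mul_apply, inv_mul_cancel, H1ColimTwist_one_apply,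
      H1ColimTwist_one_apply] at h
  · -- (T) in `Aut(μ)`-form from the `Ẑ^×`-form
    intro e w h
    have hh := hT e (χ w) h
    rw [hχ_twist] at hh
    exact hh

/-! ## §3 NON-VACUITY: (E) and (T) hold at the symmetric datum (étale side := Frobenioid side) -/

open scoped Classical in
/-- **Non-vacuity of the étale laws (E) (T) of `uniqueCyclotomeIso_infκ_fieldLevel_of_etale_laws`**: at
abc-iut-f-190's symmetric genuine datum — étale side := the Frobenioid side itself, `induced e :=` the container twist
by the cyclotomic character `χ(e)` — (E) holds with `e₀ = 1` and (T) holds (the character is multiplicative: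
`χ((twist u) ∘ e) = u · χ(e)` by injectivity of `zhatTwist`, and `H1ColimTwist` is an action), under conjunct 1's
field-level binders.  Inhabited ≠ discharged: print's étale side is the [AbsTopIII] Thm 1.9 output, not this model.
([IUTchI] Ex 5.1 (v) p.128) [claim: Mochizuki2012, status: disputed] -/
theorem etale_laws_infκ_fieldLevel_symmetric
    (hrootU : ∀ {n : ℕ}, n ≠ 0 → Function.Surjective fun a : N.Kratˣ => a ^ n)
    (hprim : ∀ n : ℕ, 0 < n → ∃ ζ : N.Krat, IsPrimitiveRoot ζ n)
    (hdiv : ∀ (H : OpenNormalSubgroup N.piRat) (a : N.Krat), a ≠ 0 → (∀ h : N.piRat, h ∈ H → h • a = a) →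
      (∀ n : ℕ+, ∃ b : N.Krat, (∀ h : N.piRat, h ∈ H → h • b = b) ∧ b ^ (n : ℕ) = a) → a = 1)
    {X : Type*} (ord : X → N.Krat → ℤ)
    (hordmul : ∀ (x : X) (a b : N.Krat), a ≠ 0 → b ≠ 0 → (∀ g : N.piRat, g • a = a) → (∀ g : N.piRat, g • b = b) →
      ord x (a * b) = ord x a + ord x b)
    (hpole : ∀ f' ∈ N.Minfκ, (∀ g : N.piRat, g • f' = f') →
      ∀ x₁ x₂ : X, x₁ ≠ x₂ → ¬ (ord x₁ f' < 0 ∧ ord x₂ f' < 0))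
    (hex : ∃ f ∈ N.Minfκ, (∀ g : N.piRat, g • f = f) ∧
      ∃ x₁ x₂ : X, x₁ ≠ x₂ ∧ 0 < ord x₁ f ∧ 0 < ord x₂ f) :
    letI : MulDistribMulAction N.piRat N.Kratˣ := Units.mulDistribMulActionRight
    letI : RootableBy N.Kratˣ ℕ := rootableByOfPowLeftSurj N.Kratˣ ℕ hrootU
    haveI : Nonempty (OpenNormalSubgroup N.piRat)ᵒᵈ :=
      ⟨OrderDual.toDual { toOpenSubgroup := ⊤, isNormal' := Subgroup.normal_of_characteristic ⊤ }⟩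
    (∃ e₀ : cyclotome N.Kratˣ ≃* cyclotome N.Kratˣ,
      Set.BijOn (fun z => H1ColimTwist
          (fun i : (OpenNormalSubgroup N.piRat)ᵒᵈ => ((OrderDual.ofDual i : OpenNormalSubgroup N.piRat) : Subgroup N.piRat))
          N.openNormal_antitone
          ((Equiv.ofBijective _ (cyclotome.zhatTwist_bijective (R := N.Krat) hprim)).symm e₀) z)
        (Set.range fun f : N.infκPair.carrier =>
          kummerMap N.openNormal_antitone (N.isExhausted_openNormal fun _ _ => rfl)
            (Units.mk0 (f : N.Krat) (N.coe_infκPair_ne_zero f)))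
        (Set.range fun f : N.infκPair.carrier =>
          kummerMap N.openNormal_antitone (N.isExhausted_openNormal fun _ _ => rfl)
            (Units.mk0 (f : N.Krat) (N.coe_infκPair_ne_zero f)))) ∧
    (∀ (e : cyclotome N.Kratˣ ≃* cyclotome N.Kratˣ) (u : MulAut (completion (GrpCat.of (Multiplicative ℤ))))
      (h : H1Colimit N.Kratˣ
        (fun i : (OpenNormalSubgroup N.piRat)ᵒᵈ => ((OrderDual.ofDual i : OpenNormalSubgroup N.piRat) : Subgroup N.piRat))
        N.openNormal_antitone),
      H1ColimTwist
          (fun i : (OpenNormalSubgroup N.piRat)ᵒᵈ => ((OrderDual.ofDual i : OpenNormalSubgroup N.piRat) : Subgroup N.piRat))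
          N.openNormal_antitone
          ((Equiv.ofBijective _ (cyclotome.zhatTwist_bijective (R := N.Krat) hprim)).symm
            (e.trans (cyclotome.zhatTwist N.Kratˣ u))) h =
        H1ColimTwist
          (fun i : (OpenNormalSubgroup N.piRat)ᵒᵈ => ((OrderDual.ofDual i : OpenNormalSubgroup N.piRat) : Subgroup N.piRat))
          N.openNormal_antitone u
          (H1ColimTwist
            (fun i : (OpenNormalSubgroup N.piRat)ᵒᵈ => ((OrderDual.ofDual i : OpenNormalSubgroup N.piRat) : Subgroup N.piRat))
            N.openNormal_antitone
            ((Equiv.ofBijective _ (cyclotome.zhatTwist_bijective (R := N.Krat) hprim)).symm e) h)) := by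
  letI : MulDistribMulAction N.piRat N.Kratˣ := Units.mulDistribMulActionRight
  letI : RootableBy N.Kratˣ ℕ := rootableByOfPowLeftSurj N.Kratˣ ℕ hrootU
  haveI : Nonempty (OpenNormalSubgroup N.piRat)ᵒᵈ :=
    ⟨OrderDual.toDual { toOpenSubgroup := ⊤, isNormal' := Subgroup.normal_of_characteristic ⊤ }⟩
  set χ := (Equiv.ofBijective _ (cyclotome.zhatTwist_bijective (R := N.Krat) hprim)).symm with hχ
  have hχ_twist : ∀ w : MulAut (cyclotome N.Kratˣ), cyclotome.zhatTwist N.Kratˣ (χ w) = w :=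
    fun w => Equiv.ofBijective_apply_symm_apply _ _ w
  refine ⟨(N.uniqueCyclotomeIso_infκ_fieldLevel hrootU hprim hdiv ord hordmul hpole hex).existsUnique.exists,
    fun e u h => ?_⟩
  -- multiplicativity of the character: `χ ((twist u) ∘ e) = u * χ e`, by injectivity of `zhatTwist`
  have hmul : χ (e.trans (cyclotome.zhatTwist N.Kratˣ u)) = u * χ e := by
    apply (cyclotome.zhatTwist_bijective (R := N.Krat) hprim).1
    rw [hχ_twist, map_mul, hχ_twist]
    exact MulEquiv.ext fun x => rfl
  rw [hmul, H1ColimTwist_mul_apply]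

end NFBridgeRecon

end Literature.IUT.HodgeTheaters
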